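import Summits.FinalStateConjecture.FinalStateConjecture.Theorems.BulkKerrCapture.Negative.PointwiseVsUniform
import Summits.FinalStateConjecture.FinalStateConjecture.Theorems.BulkKerrCaptureC2.Negative.BlockForm
import Summits.FinalStateConjecture.FinalStateConjecture.Theorems.NearExtremalKappaCapture.Negative.ExponentMonotonicity
import Summits.FinalStateConjecture.FinalStateConjecture.Theorems.PhaseMixingCaptureCaptureSufficesReduction
import Summits.FinalStateConjecture.FinalStateConjecture.Theorems.PhaseMixingCaptureBulkKerrCaptureC2OfClaim
import Literature.Geometry.Lorentzian.KerrStabilitySubextremalCauchy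
import HarnessLib

/-!
# Line `SketchStandalone` (= idea `all-orders-lebesgue-port`) for crux `BulkKerrCaptureC2`
(stmt-FinalStateConjecture-14985) — skeleton v3 (line lead `prover-line-stmt-FinalStateConjecture-14985-c1-0`,
continuation of `…-14985-0`, 2026-08-16; re-registered UNCHANGED by continuation lead
`prover-line-stmt-FinalStateConjecture-14985-c2-0`, cycle 3, 2026-08-16T13:55Z, and by continuation lead
`prover-line-stmt-FinalStateConjecture-14985-c3-0`, cycle 4, 2026-08-16T14:30Z: rc 0, ONE `sorry` = Stub 1 = the named
claim; Stubs 2/2′/3/4 LANDED p96721 / p99464 / p106217; cycle-4 independent junk audit of the conclusion side — sojourn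
far-completeness / `IsMaximalGeodesicOn` / `causalFuture`, `ConvergesTo … 2` / `IsLateEmbedding` / `deviationCk`,
`IsMaximal` transport — found no vacuous proof and no constructible `¬`, see `Cruxes/BulkKerrCaptureC2/NOTES.md`;
re-registered UNCHANGED by continuation lead `prover-line-stmt-FinalStateConjecture-14985-c4-0`, cycle 5,
2026-08-16T14:40Z, after an independent audit of the HYPOTHESIS classes — `Kerr.Facts` and `Kerr.SliceFacts` are
theorems (`Kerr.isConnected_region_holds` / `Kerr.contMDiff_bilin_holds` / `Kerr.contMDiff_timeVector_holds`, assembled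
e.g. as `Theorems.ZeroEnergyKerrOrBombSymplecticDualOfTheBombDefs.kerrFacts`; `Kerr.sliceFacts_holds`), so no proof from an inconsistent instance
hypothesis exists either — and of `Spacetime` (T2, second countable, connected: no exotic-development attack on
`IsMaximal`); item verdict recorded in the cycle-5 evidence note)

Route `PhaseMixingCapture`, rank-4 crux
`Summit.FinalStateConjecture.FinalStateConjecture.Theses.PhaseMixingCapture.BulkKerrCaptureC2` (typing
ruling 2026-08-16: sub-extremal Kerr capture in the bulk in IMPORT GRADE with the convergence order
handed over — at the horizon-penetrating Kerr–Schild leaf `r₀ = M`, for every `a₁ < 1` one `(s, δ)` and,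
per mass `M > 0` and tolerance `η > 0`, one `ε > 0` serve every spin `|a| ≤ a₁ M`: b-conormal vacuum data
`ε`-close to `Kerr.data M a M` have all MGHDs far-complete (sojourn form, inlined), a region converging in
`C²` to a sub-extremal Kerr `g_{M',a'}`, `|M' − M| + |a' − a| ≤ η`). Picked line: ideator 2's
`Cruxes/BulkKerrCaptureC2/SketchIdeator2.lean` (= payload `SketchStandalone`; `SketchLocal` is the same
line over local copies), card `Cruxes/BulkKerrCaptureC2/Ideas/all-orders-lebesgue-port.md`.

## What v3 changes (continuation lead, 2026-08-16)

v2 (lead `…-14985-0`) closed the crux modulo ONE stub, the named claim, by the composition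
claim ⇒ far form of the crux (Lebesgue number) ⇒ crux. v3 keeps that composition (`BulkKerrCaptureC2_of'`,
all its stubs LANDED) and FACTORS the main composition through the crux's NORMAL FORM, so that the
skeleton displays the exact slice of the claim the crux consumes — and consumes nothing less:

  `BulkKerrCaptureC2_of := stub_bulkKerrCaptureC2_iff_unitLeafGermTwo.2`
  `  (stub_unitLeafGermTwo_of_allOrdersClaim stub_hintzClaimAllOrders)`

* `stub_hintzClaimAllOrders` (Stub 1, OPEN = the crux's debt) — the Literature claim
  `Literature.Geometry.Lorentzian.hintz_kerr_stability_subextremal_cauchy_allOrders` BY NAME (LANDED as a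
  claim-tagged `def`, p88775, `@[claim "Hintz2026" "under-review"]`; unit-leaf germ `….atUnitLeaf`,
  p97189): Hintz arXiv:2606.28253v2 Thm. 1.1 / Thm. 13.1 with (13.2) + Rem. 13.2–13.3, convergence order
  universal. THE ONLY `sorry` OF THIS FILE. Closes only by a `_holds` discharge of that unrefereed
  509-page Nash–Moser theorem — the named fact the item is `blocked-on`.
* `stub_unitLeafGermTwo_of_allOrdersClaim` (Stub 3, PROVED below; lands in
  `Theorems/PhaseMixingCaptureBulkKerrCaptureC2NormalForm.lean`) — the bridge: the claim (all instances)
  gives the ORDER-TWO UNIT-LEAF GERM (`….atUnitLeaf` with `∀ k` instantiated at `k = 2`).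
* `stub_bulkKerrCaptureC2_iff_unitLeafGermTwo` (Stub 4, PROVED below; lands in the same file) — the
  NORMAL FORM: `BulkKerrCaptureC2 ↔` the order-two unit-leaf germ (locally uniform in the centre).
  `←` is the Lebesgue number of a finite subcover of `[−a₁, a₁] ⊂ (−1, 1)` (`uniform_of_locallyUniform`,
  abstract over a predicate monotone in `(s, δ)`, antitone in `ε`; block
  `Theorems.BulkKerrCaptureC2.Negative.CaptureC2At`, p99148); `→` takes `a₁ := (1 + |χ|)/2`, spin radius
  `(1 − |χ|)/2`.
* `stub_c2Far_of_allOrdersBody` / `stub_c2Far_of_allOrdersClaim` (Stubs 2/2′ of v2, LANDED p96721 /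
  p99464) — claim (body / by name) ⇒ far form of the crux; used by the v2 composition
  `BulkKerrCaptureC2_of'` kept below.

So the skeleton is CLOSED MODULO STUB 1 = the named claim, and Stub 4 certifies that this is tight:
the crux is EQUIVALENT to the (`ρ₀ = 1`, `k = 2`, locally-uniform) instance of the claim, so no line
can close it with less, and any source for that instance (e.g. a refereed version of Hintz's theorem,
or a finite-regularity theorem of Klainerman–Szeftel shape extended to the full range) closes it through
`stub_bulkKerrCaptureC2_iff_unitLeafGermTwo.2`.

DISPROOF USED (`Cruxes/BulkKerrCaptureC2/Disproof.lean`, cdisprove cycle 1, 12:14Z, verdict NO KILL):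
§7 `stub1_iff_claim` (`Iff.rfl`: Stub 1 is definitionally the named claim — nothing smuggled);
`bulkKerrCaptureC2_pointwise` (crux ⇒ pointwise `k = 2` claim shape; Stub 4 is its sharp form with the
local uniformity kept); §5 load-bearing: `a₁ < 1` is used exactly once (Stub 4 `←`, `[−a₁, a₁] ⊂ (−1, 1)`)
and `0 < M` forms `a/M`, as `captureC2Family_false_of_one_le_of_rigidity` /
`_false_of_mass_zero_of_rigidity` demand; `-- Targets`: none posted against this line's stubs.
-/

-- the doubled `FinalStateConjecture.FinalStateConjecture` path component trips dupNamespace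
set_option linter.dupNamespace false

noncomputable section

open Set Filter Topology Function
open scoped Manifold ContDiff ENNReal Topology
open Literature.Geometry.Lorentzian
open Summit.FinalStateConjecture.FinalStateConjecture.Theorems.BulkKerrCapture
open Summit.FinalStateConjecture.FinalStateConjecture.Theorems.BulkKerrCaptureC2 (Negative.CaptureC2At)
open Summit.FinalStateConjecture.FinalStateConjecture.Theses.PhaseMixingCapture (BulkKerrCaptureC2)

namespace Summit.FinalStateConjecture.FinalStateConjecture.Cruxes.BulkKerrCaptureC2.AllOrdersLebesguePort

/-! ## §0 Helper lemmas of the line (proved; land with Stubs 3–4) -/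

/-- **Abstract spin-cover lemma (Lebesgue number).** Let `Good s δ M hM η ε a` be monotone in the
exponents `(s, δ)` and antitone in the radius `ε`. If every normalised centre `χ` with `|χ| < 1` has
exponents `(s, δ)`, a spin radius `ς > 0` and, per `(M, η)`, a radius `ε > 0` serving every spin with
`|a/M − χ| < ς`, then for every `a₁ < 1` some `(s, δ)` and, per `(M, η)`, some `ε > 0` serve every
`|a| ≤ a₁ M`: cover the compact segment `[−a₁, a₁] ⊂ (−1, 1)` by the spin balls, extract a finite
subcover, take `max s`, `max δ` and, per `(M, η)`, `min ε`. [folklore] -/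
theorem uniform_of_locallyUniform
    (Good : ℕ → ℝ → (M : ℝ) → 0 < M → ℝ → ℝ → ℝ → Prop)
    (hmono : ∀ {s s' : ℕ} {δ δ' : ℝ} {M : ℝ} {hM : 0 < M} {η ε ε' a : ℝ},
      s ≤ s' → δ ≤ δ' → ε' ≤ ε → Good s δ M hM η ε a → Good s' δ' M hM η ε' a)
    (hloc : ∀ χ : ℝ, |χ| < 1 → ∃ (s : ℕ) (δ : ℝ), ∃ ς > (0 : ℝ), ∀ (M : ℝ) (hM : 0 < M),
      ∀ η > (0 : ℝ), ∃ ε > (0 : ℝ), ∀ a : ℝ, |a / M - χ| < ς → Good s δ M hM η ε a) :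
    ∀ a₁ : ℝ, a₁ < 1 → ∃ (s : ℕ) (δ : ℝ), ∀ (M : ℝ) (hM : 0 < M), ∀ η > (0 : ℝ), ∃ ε > (0 : ℝ),
      ∀ a : ℝ, |a| ≤ a₁ * M → Good s δ M hM η ε a := by
  intro a₁ ha₁
  classical
  rcases lt_or_ge a₁ 0 with hneg | hnn
  · exact ⟨0, 0, fun M hM η _ ↦ ⟨1, one_pos, fun a ha ↦
      (Negative.no_spin_of_neg hneg hM ha).elim⟩⟩
  set K : Set ℝ := Icc (-a₁) a₁ with hK
  have hKc : IsCompact K := isCompact_Icc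
  have hKsub : ∀ χ ∈ K, |χ| < 1 := fun χ hχ ↦ by
    rw [hK, mem_Icc] at hχ
    exact abs_lt.2 ⟨by linarith [hχ.1], by linarith [hχ.2]⟩
  choose! s δ ς hς hcap using fun χ (hχ : χ ∈ K) ↦ hloc χ (hKsub χ hχ)
  have hcover : K ⊆ ⋃ χ ∈ K, Metric.ball χ (ς χ) := fun χ hχ ↦
    mem_biUnion hχ (Metric.mem_ball_self (hς χ hχ))
  obtain ⟨t, htK, htfin, hsub⟩ :=
    hKc.elim_finite_subcover_image (fun χ _ ↦ Metric.isOpen_ball) hcover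
  have hKne : K.Nonempty := ⟨0, by rw [hK, mem_Icc]; exact ⟨by linarith, hnn⟩⟩
  have htne : t.Nonempty := by
    obtain ⟨x, hx⟩ := hKne
    have hx' := hsub hx
    simp only [mem_iUnion] at hx'
    obtain ⟨i, hi, -⟩ := hx'
    exact ⟨i, hi⟩
  obtain ⟨iS, -, hsmax⟩ := t.exists_max_image s htfin htne
  obtain ⟨iD, -, hdmax⟩ := t.exists_max_image δ htfin htne
  refine ⟨s iS, δ iD, fun M hM η hη ↦ ?_⟩
  choose! ε hε hbody using fun χ (hχ : χ ∈ t) ↦ hcap χ (htK hχ) M hM η hη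
  obtain ⟨iE, hiEt, hemin⟩ := t.exists_min_image ε htfin htne
  refine ⟨ε iE, hε iE hiEt, fun a ha ↦ ?_⟩
  have hχK : a / M ∈ K := by
    rw [hK, mem_Icc, ← abs_le, abs_div, abs_of_pos hM, div_le_iff₀ hM]
    exact ha
  have ha' := hsub hχK
  simp only [mem_iUnion] at ha'
  obtain ⟨χ₀, hχ₀t, hball⟩ := ha'
  have hnear : |a / M - χ₀| < ς χ₀ := by simpa [Metric.mem_ball, Real.dist_eq] using hball
  exact hmono (hsmax χ₀ hχ₀t) (hdmax χ₀ hχ₀t) (hemin χ₀ hχ₀t) (hbody χ₀ hχ₀t a hnear)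

/-- A spin within `(1 − |χ|)/2` of a normalised centre `χ` (in units of a positive mass `M`) lies
below the threshold `a₁ := (1 + |χ|)/2 < 1`: `|a| ≤ (1 + |χ|)/2 · M`. [folklore] -/
theorem spin_le_of_near_centre {M a χ : ℝ} (hM : 0 < M) (h : |a / M - χ| < (1 - |χ|) / 2) :
    |a| ≤ (1 + |χ|) / 2 * M := by
  have h1 : |a / M| ≤ |χ| + (1 - |χ|) / 2 := by
    have := abs_sub_abs_le_abs_sub (a / M) χ
    linarith
  rw [abs_div, abs_of_pos hM, div_le_iff₀ hM] at h1
  linarith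

/-- **Normal form, block version.** `BulkKerrCaptureC2` ↔ locally-uniform pointwise `C²` capture at
the unit normalised leaf (block `Negative.CaptureC2At`, p99148): around every normalised
sub-extremal centre `χ`, exponents `(s, δ)`, a spin radius `ς > 0` and per `(M, η)` one basin `ε`
serving every sub-extremal spin with `|a/M − χ| < ς`. [folklore] -/
theorem bulkKerrCaptureC2_iff_locallyUniform :
    BulkKerrCaptureC2 ↔
      ∀ [Kerr.Facts] [Kerr.SliceFacts], ∀ χ : ℝ, |χ| < 1 → ∃ (s : ℕ) (δ : ℝ), ∃ ς > (0 : ℝ),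
        ∀ (M : ℝ) (hM : 0 < M), ∀ η > (0 : ℝ), ∃ ε > (0 : ℝ), ∀ a : ℝ, |a / M - χ| < ς →
          Kerr.IsSubextremal M a → Negative.CaptureC2At s δ M hM.le ε η a := by
  rw [Theorems.BulkKerrCaptureC2.Negative.bulkKerrCaptureC2_iff_captureC2At]
  constructor
  · intro h _ _ χ hχ
    have ha₁ : (1 + |χ|) / 2 < 1 := by linarith
    obtain ⟨s, δ, H⟩ := h ((1 + |χ|) / 2) ha₁
    refine ⟨s, δ, (1 - |χ|) / 2, by linarith, fun M hM η hη ↦ ?_⟩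
    obtain ⟨ε, hε, Hε⟩ := H M hM η hη
    exact ⟨ε, hε, fun a ha _ ↦ Hε a (spin_le_of_near_centre hM ha)⟩
  · intro h _ _
    refine uniform_of_locallyUniform (fun s δ M hM η ε a ↦ Negative.CaptureC2At s δ M hM.le ε η a)
      (fun hs hδ hε hg ↦ hg.mono hs hδ hε le_rfl) fun χ hχ ↦ ?_
    obtain ⟨s, δ, ς, hς, H⟩ := h χ hχ
    refine ⟨s, δ, min ς ((1 - |χ|) / 2), lt_min hς (by linarith), fun M hM η hη ↦ ?_⟩
    obtain ⟨ε, hε, Hε⟩ := H M hM η hη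
    refine ⟨ε, hε, fun a ha ↦ Hε a (ha.trans_le (min_le_left _ _)) ?_⟩
    exact Negative.isSubextremal_of_spin_le (a₁ := (1 + |χ|) / 2) (by linarith) hM
      (spin_le_of_near_centre hM (ha.trans_le (min_le_right _ _)))

/-! ## §1 Registered stubs -/

/-- **Stub 1 — the vendored claim, BY NAME** `Literature.Geometry.Lorentzian.hintz_kerr_stability_subextremal_cauchy_allOrders`
(LANDED p88775, claim-tagged `Hintz2026`/under-review; closes only
by a `_holds` discharge of that fact): for every normalised sub-extremal centre `χ₀` and normalised inner
radius `ρ₀` between the unit-mass horizons there are `(s, δ, ς)`; per mass `M > 0` and tolerance `η > 0`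
one basin `ε`; for every spin `a` with `|a/M − χ₀| < ς` at `r₀ = ρ₀ M ∈ (r₋, r₊)`, every b-conormal
(`∀ s', dist_{s',δ} < ⊤`) vacuum datum `ε`-close at order `s` to `Kerr.data M a r₀` has all MGHDs with a
sub-extremal `(M', a')`, `|M' − M| + |a' − a| ≤ η`, far-complete `𝓘⁺`, and `Cᵏ`-convergence to
`g_{M',a'}` for EVERY `k`. Hintz arXiv:2606.28253v2 Thm. 1.1 (p. 2) / Thm. 13.1 with (13.2) (pp. 318–319) /
Rem. 13.2–13.3 (pp. 319–320). Size XL as mathematics, 0 as Lean once the fact is citable. THE ONLY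
`sorry`: the item is `blocked-on` this named fact.
[cite: Hintz2026, Thm. 13.1 (pp. 318–319) and Remark 13.2 (p. 319)] -/
theorem stub_hintzClaimAllOrders :
    ∀ [Kerr.Facts] [Kerr.SliceFacts], hintz_kerr_stability_subextremal_cauchy_allOrders := by
  sorry

/-- **Stub 3 — the bridge (PROVED; lands in `Theorems/PhaseMixingCaptureBulkKerrCaptureC2NormalForm.lean`).**
The claim (all instances of the two `Prop`-classes) gives the ORDER-TWO UNIT-LEAF GERM: around every
normalised sub-extremal centre `χ₀`, `(s, δ)`, a spin radius `ς > 0` and per `(M, η)` one `ε > 0`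
such that for every sub-extremal spin with `|a/M − χ₀| < ς` every b-conormal `ε`-close vacuum datum on
`Kerr.slice a M` has all MGHDs with sub-extremal final parameters within `η`, far-complete `𝓘⁺` and a
region converging in `C²` (`….atUnitLeaf`, p97189, at `k := 2`).
[cite: Hintz2026, Thm. 13.1 (pp. 318–319) and Remark 13.2 (p. 319)] -/
theorem stub_unitLeafGermTwo_of_allOrdersClaim :
    (∀ [Kerr.Facts] [Kerr.SliceFacts], hintz_kerr_stability_subextremal_cauchy_allOrders) →
    ∀ [Kerr.Facts] [Kerr.SliceFacts], ∀ χ₀ : ℝ, |χ₀| < 1 →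
      ∃ (s : ℕ) (δ : ℝ), ∃ ς > (0 : ℝ), ∀ (M : ℝ) (hM : 0 < M), ∀ η > (0 : ℝ), ∃ ε > (0 : ℝ),
        ∀ a : ℝ, |a / M - χ₀| < ς → Kerr.IsSubextremal M a →
          ∀ (D : InitialDataSet 𝓘(ℝ, E3) (Kerr.slice a M)) [D.metric.HasLeviCivita],
            D.IsVacuumConstraintSolution →
            (∀ s' : ℕ,
              InitialDataSet.dataWeightedSobolevEDist s' δ D (Kerr.data M a M hM.le) < ⊤) →
            InitialDataSet.dataWeightedSobolevEDist s δ D (Kerr.data M a M hM.le) <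
              ENNReal.ofReal ε →
            ∀ 𝒟 : VacuumCauchyDevelopment D, 𝒟.IsMaximal →
              ∃ (M' a' : ℝ) (𝒟oc : Set 𝒟.carrier), Kerr.IsSubextremal M' a' ∧
                |M' - M| + |a' - a| ≤ η ∧
                𝒟.HasCompleteFutureNullInfinityFar ∧
                𝒟.toSpacetime.ConvergesToKerr 𝒟oc M' a' 2 := by
  intro hclaim _ _ χ₀ hχ₀
  obtain ⟨s, δ, ς, hς, H⟩ := hclaim.atUnitLeaf χ₀ hχ₀
  refine ⟨s, δ, ς, hς, fun M hM η hη ↦ ?_⟩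
  obtain ⟨ε, hε, Hε⟩ := H M hM η hη
  refine ⟨ε, hε, fun a ha hsub D _ hvac hcon hdist 𝒟 hmax ↦ ?_⟩
  obtain ⟨M', a', 𝒟oc, hsub', hpar, hfar, hconv⟩ := Hε a ha hsub D hvac hcon hdist 𝒟 hmax
  exact ⟨M', a', 𝒟oc, hsub', hpar, hfar, hconv 2⟩

/-- **Stub 4 — the NORMAL FORM of the crux (PROVED; lands in
`Theorems/PhaseMixingCaptureBulkKerrCaptureC2NormalForm.lean`).** `BulkKerrCaptureC2` ↔ the order-two
unit-leaf germ, i.e. the statement of `hintz_kerr_stability_subextremal_cauchy_allOrders.atUnitLeaf` with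
`∀ k` replaced by `k = 2`. `→`: threshold `a₁ := (1 + |χ₀|)/2`, spin radius `(1 − |χ₀|)/2`; `←`: the
Lebesgue number of a finite subcover of `[−a₁, a₁] ⊂ (−1, 1)` (`uniform_of_locallyUniform`) with the
`(s, δ)`-monotonicity of the block (`Negative.CaptureC2At.mono`). Certifies that the line's debt is
tight: the crux is EQUIVALENT to this instance of the claim. [folklore] -/
theorem stub_bulkKerrCaptureC2_iff_unitLeafGermTwo :
    BulkKerrCaptureC2 ↔
      ∀ [Kerr.Facts] [Kerr.SliceFacts], ∀ χ₀ : ℝ, |χ₀| < 1 →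
        ∃ (s : ℕ) (δ : ℝ), ∃ ς > (0 : ℝ), ∀ (M : ℝ) (hM : 0 < M), ∀ η > (0 : ℝ), ∃ ε > (0 : ℝ),
          ∀ a : ℝ, |a / M - χ₀| < ς → Kerr.IsSubextremal M a →
            ∀ (D : InitialDataSet 𝓘(ℝ, E3) (Kerr.slice a M)) [D.metric.HasLeviCivita],
              D.IsVacuumConstraintSolution →
              (∀ s' : ℕ,
                InitialDataSet.dataWeightedSobolevEDist s' δ D (Kerr.data M a M hM.le) < ⊤) →
              InitialDataSet.dataWeightedSobolevEDist s δ D (Kerr.data M a M hM.le) <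
                ENNReal.ofReal ε →
              ∀ 𝒟 : VacuumCauchyDevelopment D, 𝒟.IsMaximal →
                ∃ (M' a' : ℝ) (𝒟oc : Set 𝒟.carrier), Kerr.IsSubextremal M' a' ∧
                  |M' - M| + |a' - a| ≤ η ∧
                  𝒟.HasCompleteFutureNullInfinityFar ∧
                  𝒟.toSpacetime.ConvergesToKerr 𝒟oc M' a' 2 := by
  rw [bulkKerrCaptureC2_iff_locallyUniform]
  constructor
  · intro h _ _ χ₀ hχ₀
    obtain ⟨s, δ, ς, hς, H⟩ := h χ₀ hχ₀
    refine ⟨s, δ, ς, hς, fun M hM η hη ↦ ?_⟩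
    obtain ⟨ε, hε, Hε⟩ := H M hM η hη
    refine ⟨ε, hε, fun a ha hsub D _ hvac hcon hdist 𝒟 hmax ↦ ?_⟩
    obtain ⟨M', a', 𝒟oc, hsub', hfar, hconv, hpar⟩ := Hε a ha hsub D hvac hcon hdist 𝒟 hmax
    exact ⟨M', a', 𝒟oc, hsub', hpar, hfar, hconv⟩
  · intro h _ _ χ₀ hχ₀
    obtain ⟨s, δ, ς, hς, H⟩ := h χ₀ hχ₀
    refine ⟨s, δ, ς, hς, fun M hM η hη ↦ ?_⟩
    obtain ⟨ε, hε, Hε⟩ := H M hM η hη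
    refine ⟨ε, hε, fun a ha hsub D _ hvac hcon hdist 𝒟 hmax ↦ ?_⟩
    obtain ⟨M', a', 𝒟oc, hsub', hpar, hfar, hconv⟩ := Hε a ha hsub D hvac hcon hdist 𝒟 hmax
    exact ⟨M', a', 𝒟oc, hsub', hfar, hconv, hpar⟩

/-- **Stub 2 (v2) — the Lebesgue number in far form (lead `…-14985-0`; PROVED and LANDED, p96721).**
The claim body (Stub 1's statement as a hypothesis) implies the FAR FORM of the crux
(`PhaseMixingCaptureCaptureSuffices.bulkKerrCaptureC2_iff.2` then gives `BulkKerrCaptureC2` by name in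
the v2 composition `BulkKerrCaptureC2_of'`): cover `[−a₁, a₁] ⊂ (−1, 1)` by the claim's spin balls at
`ρ₀ = 1`, finite subcover, `max s`, `max δ`, `min ε`, `dataWeightedSobolevEDist_mono`, `k := 2`.
[folklore] -/
theorem stub_c2Far_of_allOrdersBody :
    (∀ [Kerr.Facts] [Kerr.SliceFacts],
      ∀ χ₀ : ℝ, |χ₀| < 1 → ∀ ρ₀ ∈ Set.Ioo (1 - √(1 - χ₀ ^ 2)) (1 + √(1 - χ₀ ^ 2)),
        ∃ (s : ℕ) (δ : ℝ), ∃ ς > (0 : ℝ), ∀ (M : ℝ) (hM : 0 < M), ∀ η > (0 : ℝ), ∃ ε > (0 : ℝ),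
          ∀ a r₀ : ℝ, |a / M - χ₀| < ς → r₀ = ρ₀ * M →
            r₀ ∈ Set.Ioo (Kerr.rMinus M a) (Kerr.rPlus M a) →
            ∀ (D : InitialDataSet 𝓘(ℝ, E3) (Kerr.slice a r₀)) [D.metric.HasLeviCivita],
              D.IsVacuumConstraintSolution →
              (∀ s' : ℕ,
                InitialDataSet.dataWeightedSobolevEDist s' δ D (Kerr.data M a r₀ hM.le) < ⊤) →
              InitialDataSet.dataWeightedSobolevEDist s δ D (Kerr.data M a r₀ hM.le) <
                ENNReal.ofReal ε →
              ∀ 𝒟 : VacuumCauchyDevelopment D, 𝒟.IsMaximal →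
                ∃ (M' a' : ℝ) (𝒟oc : Set 𝒟.carrier), Kerr.IsSubextremal M' a' ∧
                  |M' - M| + |a' - a| ≤ η ∧
                  𝒟.HasCompleteFutureNullInfinityFar ∧
                  ∀ k : ℕ, 𝒟.toSpacetime.ConvergesToKerr 𝒟oc M' a' k) →
    ∀ [Kerr.Facts] [Kerr.SliceFacts], ∀ a₁ : ℝ, a₁ < 1 → ∃ (s : ℕ) (δ : ℝ),
      ∀ (M : ℝ) (hM : 0 < M), ∀ η > (0 : ℝ), ∃ ε > (0 : ℝ), ∀ a : ℝ, |a| ≤ a₁ * M →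
        ∀ (D : InitialDataSet 𝓘(ℝ, E3) (Kerr.slice a M)) [D.metric.HasLeviCivita],
          D.IsVacuumConstraintSolution →
          (∀ s' : ℕ,
            InitialDataSet.dataWeightedSobolevEDist s' δ D (Kerr.data M a M hM.le) < ⊤) →
          InitialDataSet.dataWeightedSobolevEDist s δ D (Kerr.data M a M hM.le) <
            ENNReal.ofReal ε →
          ∀ 𝒟 : VacuumCauchyDevelopment D, 𝒟.IsMaximal →
            ∃ (M' a' : ℝ) (𝒟oc : Set 𝒟.carrier), Kerr.IsSubextremal M' a' ∧
              𝒟.HasCompleteFutureNullInfinityFar ∧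
              𝒟.toSpacetime.ConvergesToKerr 𝒟oc M' a' 2 ∧ |M' - M| + |a' - a| ≤ η :=
  -- LANDED: p96721 (commit c49bb1c76c26), `Theorems/PhaseMixingCaptureBulkKerrCaptureC2OfClaim.lean`
  Summit.FinalStateConjecture.FinalStateConjecture.Theorems.stub_c2Far_of_allOrdersBody

/-- **Stub 2′ (v2) — the same lever, hypothesis BY NAME (PROVED and LANDED, p99464,
`Theorems/PhaseMixingCaptureBulkKerrCaptureC2OfClaimByName.lean`).** [folklore] -/
theorem stub_c2Far_of_allOrdersClaim :
    (∀ [Kerr.Facts] [Kerr.SliceFacts], hintz_kerr_stability_subextremal_cauchy_allOrders) →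
    ∀ [Kerr.Facts] [Kerr.SliceFacts], ∀ a₁ : ℝ, a₁ < 1 → ∃ (s : ℕ) (δ : ℝ),
      ∀ (M : ℝ) (hM : 0 < M), ∀ η > (0 : ℝ), ∃ ε > (0 : ℝ), ∀ a : ℝ, |a| ≤ a₁ * M →
        ∀ (D : InitialDataSet 𝓘(ℝ, E3) (Kerr.slice a M)) [D.metric.HasLeviCivita],
          D.IsVacuumConstraintSolution →
          (∀ s' : ℕ,
            InitialDataSet.dataWeightedSobolevEDist s' δ D (Kerr.data M a M hM.le) < ⊤) →
          InitialDataSet.dataWeightedSobolevEDist s δ D (Kerr.data M a M hM.le) <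
            ENNReal.ofReal ε →
          ∀ 𝒟 : VacuumCauchyDevelopment D, 𝒟.IsMaximal →
            ∃ (M' a' : ℝ) (𝒟oc : Set 𝒟.carrier), Kerr.IsSubextremal M' a' ∧
              𝒟.HasCompleteFutureNullInfinityFar ∧
              𝒟.toSpacetime.ConvergesToKerr 𝒟oc M' a' 2 ∧ |M' - M| + |a' - a| ≤ η :=
  -- LANDED verbatim as `Summit.FinalStateConjecture.FinalStateConjecture.Theorems.stub_c2Far_of_allOrdersClaim`
  -- (p99464); the one-line proof is repeated here so this file does not depend on that module's olean.
  fun hclaim ↦ stub_c2Far_of_allOrdersBody hclaim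

/-! ## §2 The composition -/

/-- **Composition (v3; closed term over the registered stubs; concludes the crux BY NAME).**
claim (Stub 1) ⇒ order-two unit-leaf germ (Stub 3) ⇒ crux (Stub 4, normal form, `.2`). Depends on
`sorryAx` only through Stub 1 = the named claim. [folklore] -/
theorem BulkKerrCaptureC2_of : BulkKerrCaptureC2 :=
  stub_bulkKerrCaptureC2_iff_unitLeafGermTwo.2
    (stub_unitLeafGermTwo_of_allOrdersClaim stub_hintzClaimAllOrders)

/-- **Composition (v2, kept; all its stubs landed).** claim (Stub 1) ⇒ far form of the crux
(Stub 2′) ⇒ crux (tree lemma `Theorems.PhaseMixingCaptureCaptureSuffices.bulkKerrCaptureC2_iff`).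
[folklore] -/
theorem BulkKerrCaptureC2_of' : BulkKerrCaptureC2 :=
  Theorems.PhaseMixingCaptureCaptureSuffices.bulkKerrCaptureC2_iff.2
    (stub_c2Far_of_allOrdersClaim stub_hintzClaimAllOrders)

end Summit.FinalStateConjecture.FinalStateConjecture.Cruxes.BulkKerrCaptureC2.AllOrdersLebesguePort

end
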